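/-
Copyright (c) 2026 the pub-hodgecm-mathlib formalisation cell (harness21).  Prover seat hodgecm-mathlib-K2E5-p10 (g2),
Track B «K2-LIT» ∕ h413 (stmt-HodgeConjecture-24833), engine E5 «TamagawaUnitary», unit G (ZETA-RATIO COMPARISON), organ G14:
the LIMIT-UNIQUENESS SKELETON of the comparison `V(h)/V(h′) = lim_{s→1⁺} Z_h(s)/Z_{h′}(s)` (pure real∕complex analysis, Mathlib only).  2026-09-04.
-/
import Mathlib.Topology.Algebra.GroupWithZero
import Mathlib.Analysis.Complex.Basic
import HarnessLib

/-!
# K2_E5 road (h413 = stmt-HodgeConjecture-24833), unit G organ G14: the zeta-ratio ∕ limit-uniqueness skeleton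

Cell `pub/hodgecm-mathlib` (D-0151), Track B; dealer K2E5-plan (g2), SWEEP #10c (2026-09-03T23:47:03Z) (15) «BOOKED, UNDEALT (first free hand, S):
G14 limit-uniqueness skeleton `Theorems/K2E5ZetaRatioSkeleton.lean` (pure real analysis: from `Tendsto (fun s => (s−1)·Z_i s) (𝓝[>] 1) (𝓝 (V_i·P))`,
`Z_i s = C·A_i s·B_i·E s` on `Ioi 1`, `Tendsto A_i (𝓝[>]1) (𝓝 a_i)`, all constants ≠ 0, i = 1,2 ⇒ `V₁/(a₁B₁) = V₂/(a₂B₂)`)», taken by the free hand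
K2E5-p10 (g2) 2026-09-03T23:58Z.

This is the analytic backbone of cert §6 `G0D_of_sigs` (SIGS TABLE ED.6 §2 «THE COMPARISON»): for two anisotropic hermitian planes `h₁, h₂` the zeta
functions factor as `Z_i(s) = C · A_i(s) · B_i · E(s)` for real `s > 1` with a COMMON constant `C` (the β-pin ∕ product-measure constant, G13), a COMMON
good-place Euler product `E(s)` (G9∕G10: `h`-free right-hand sides off the bad set `S`), an `s`-CONSTANT bad-place factor `B_i` (G8′∕Gvol: saturated unit
test functions, `‖·‖_v ≡ 1`) and an archimedean factor `A_i(s) → a_i` (G12∞); the residues `(s − 1)·Z_i(s) → V_i · P` (G3 twice, common Poisson factor `P`)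
then force `V₁/(a₁B₁) = V₂/(a₂B₂)` — WITHOUT ever evaluating `lim_{s→1⁺} (s−1)·E(s)`: the common factor `(s−1)·E(s)` has the two limits
`V_i·P/(C·a_i·B_i)` along the SAME non-trivial filter, hence they coincide (`tendsto_nhds_unique`).  The product formula (`a₁B₁ = a₂B₂`) then gives `V₁ = V₂`.

Contents (all `theorem`s, no `def`, Mathlib only; every statement over an arbitrary Hausdorff topological field `𝕜` with continuous `·` and `⁻¹` away
from `0` and an arbitrary non-trivial filter `l`, then specialised to G3's literal shape `s : ℝ ↦ ((s : ℂ) − 1) · Z (s)` along `𝓝[>] (1 : ℝ)`):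

* §1 `tendsto_weight_mul_common_of_factorization` — `w·Z → ℓ`, `Z = A·E` eventually, `A → a ≠ 0` ⇒ `w·E → ℓ / a`;
  `limit_div_eq_of_common_factor₂` — two such factorizations with the same `w`, `E` ⇒ `ℓ₁ / a₁ = ℓ₂ / a₂`;
* §2 the dealer's four-factor form `Z_i = C·A_i·B_i·E`: `tendsto_weight_mul_common_of_factorization₄`, **`limit_div_eq_of_common_factor`**
  (`ℓ₁/(a₁B₁) = ℓ₂/(a₂B₂)`; cross-multiplied `limit_mul_eq_of_common_factor`), `limit_eq_of_common_factor` (`a₁B₁ = a₂B₂ ⇒ ℓ₁ = ℓ₂`), the residue form `residue_div_eq_of_common_factor`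
  (`ℓ_i = V_i·P`, `P ≠ 0` ⇒ `V₁/(a₁B₁) = V₂/(a₂B₂)`) and the ratio forms `tendsto_ratio_of_common_factor` ∕ `limit_ratio_eq_of_common_factor`;
* §3 the `s → 1⁺` specialisation in G3's bytes: **`zetaRatioSkeleton`** (`V_i P ∈ ℂ`), **`zetaRatioSkeleton_toReal`** and **`covol_eq_of_zetaResidue_comparison`**
  (`V_i : ℝ≥0∞` finite, limits written `((V_i.toReal : ℂ) * I_i) / (F.toReal : ℂ)` exactly as `Zeta.sig_K2E5QuatZetaResidue` :112 concludes, `I₁ = I₂` the equal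
  Poisson integrals ⇒ `V₁ = V₂` in `ℝ≥0∞` — the output currency of G0D `Zeta.sig_K2E5QuatUnitsOneCovolInvariance` :158).

[cite: VignerasLNM800, Ch. III §2 Thm. 2.2–2.3 (residue comparison ⇒ τ independent of the quaternion algebra)] [cite: WeilBNT1967, Ch. VII §6 Thm. 4]
[folklore: uniqueness of limits along a non-trivial filter in a Hausdorff space]

HONEST LABEL: HC_CM is proved only modulo the 7 printed citations (2 remaining named inputs: hLiu418 = stmt-HodgeConjecture-24832,
h413 = stmt-HodgeConjecture-24833) until rung 0 closes; this file is a `--supports stmt-HodgeConjecture-24833 --as helper` leaf and retires nothing by itself.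
-/

set_option autoImplicit false
set_option linter.dupNamespace false   -- `Summit.HodgeConjecture.HodgeConjecture.…` (D-0017 nested layout; lakefile exemption for Summits)

noncomputable section

namespace Summit.HodgeConjecture.HodgeConjecture.Cruxes.H413.K2E5ZetaRatioSkeleton

open Filter Topology
open scoped ENNReal

/-! ## §1 Two-factor core: a common factor with two limits along the same filter -/

section Core

variable {α 𝕜 : Type*} [Field 𝕜] [TopologicalSpace 𝕜] [ContinuousMul 𝕜] [ContinuousInv₀ 𝕜] [T2Space 𝕜]
  {l : Filter α}

/-- **Isolating the common factor.**  If `w·Z → ℓ` along `l`, `Z = A·E` eventually along `l` and `A → a ≠ 0`, then the weighted common factor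
`w·E` converges, to `ℓ / a` (eventually `A ≠ 0`, so `w·E = (w·Z)/A`; continuity of `·` and of `⁻¹` at `a ≠ 0`). [folklore] -/
theorem tendsto_weight_mul_common_of_factorization {w Z A E : α → 𝕜} {ℓ a : 𝕜}
    (hZ : Tendsto (fun s => w s * Z s) l (𝓝 ℓ)) (hfac : ∀ᶠ s in l, Z s = A s * E s)
    (hA : Tendsto A l (𝓝 a)) (ha : a ≠ 0) :
    Tendsto (fun s => w s * E s) l (𝓝 (ℓ / a)) := by
  refine (hZ.div hA ha).congr' ?_
  filter_upwards [hfac, hA.eventually_ne ha] with s hs hAs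
  simp only [Pi.div_apply, hs]
  field_simp

/-- **Limit uniqueness, two-factor form.**  Two factorizations `Z_i = A_i·E` (eventually along a NON-TRIVIAL filter `l`) sharing the weight `w` and the
common factor `E`, with `w·Z_i → ℓ_i` and `A_i → a_i ≠ 0`, force `ℓ₁ / a₁ = ℓ₂ / a₂`: both are the limit of `w·E` (Hausdorff ⇒ unique).
No limit of `w·E` is ever computed. [folklore] -/
theorem limit_div_eq_of_common_factor₂ [NeBot l] {w Z₁ Z₂ A₁ A₂ E : α → 𝕜} {ℓ₁ ℓ₂ a₁ a₂ : 𝕜}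
    (h₁ : Tendsto (fun s => w s * Z₁ s) l (𝓝 ℓ₁)) (h₂ : Tendsto (fun s => w s * Z₂ s) l (𝓝 ℓ₂))
    (hfac₁ : ∀ᶠ s in l, Z₁ s = A₁ s * E s) (hfac₂ : ∀ᶠ s in l, Z₂ s = A₂ s * E s)
    (hA₁ : Tendsto A₁ l (𝓝 a₁)) (hA₂ : Tendsto A₂ l (𝓝 a₂)) (ha₁ : a₁ ≠ 0) (ha₂ : a₂ ≠ 0) :
    ℓ₁ / a₁ = ℓ₂ / a₂ :=
  tendsto_nhds_unique (tendsto_weight_mul_common_of_factorization h₁ hfac₁ hA₁ ha₁)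
    (tendsto_weight_mul_common_of_factorization h₂ hfac₂ hA₂ ha₂)

/-- The common weighted factor's limit, two-factor form, read back: `w·E → ℓ₁/a₁` (and `= ℓ₂/a₂`). [folklore] -/
theorem tendsto_weight_mul_common₂ {w Z₁ A₁ E : α → 𝕜} {ℓ₁ a₁ : 𝕜}
    (h₁ : Tendsto (fun s => w s * Z₁ s) l (𝓝 ℓ₁)) (hfac₁ : ∀ᶠ s in l, Z₁ s = A₁ s * E s)
    (hA₁ : Tendsto A₁ l (𝓝 a₁)) (ha₁ : a₁ ≠ 0) :
    Tendsto (fun s => w s * E s) l (𝓝 (ℓ₁ / a₁)) :=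
  tendsto_weight_mul_common_of_factorization h₁ hfac₁ hA₁ ha₁

end Core

/-! ## §2 The dealer's four-factor form `Z_i = C · A_i · B_i · E` -/

section FourFactor

variable {α 𝕜 : Type*} [Field 𝕜] [TopologicalSpace 𝕜] [ContinuousMul 𝕜] [ContinuousInv₀ 𝕜] [T2Space 𝕜]
  {l : Filter α}

/-- Four-factor isolation: `w·Z → ℓ`, `Z = C·A·B·E` eventually, `A → a`, `C, a, B ≠ 0` ⇒ `w·E → ℓ / (C·a·B)`. [folklore] -/
theorem tendsto_weight_mul_common_of_factorization₄ {w Z A E : α → 𝕜} {ℓ C B a : 𝕜}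
    (hZ : Tendsto (fun s => w s * Z s) l (𝓝 ℓ)) (hfac : ∀ᶠ s in l, Z s = C * A s * B * E s)
    (hA : Tendsto A l (𝓝 a)) (hC : C ≠ 0) (ha : a ≠ 0) (hB : B ≠ 0) :
    Tendsto (fun s => w s * E s) l (𝓝 (ℓ / (C * a * B))) := by
  refine tendsto_weight_mul_common_of_factorization (A := fun s => C * A s * B) hZ ?_
    ((tendsto_const_nhds.mul hA).mul tendsto_const_nhds) (mul_ne_zero (mul_ne_zero hC ha) hB)
  filter_upwards [hfac] with s hs
  rw [hs]

/-- **G14, dealer's form — `ℓ₁/(a₁B₁) = ℓ₂/(a₂B₂)`.**  Along a non-trivial filter `l`: `w·Z_i → ℓ_i`, `Z_i = C·A_i·B_i·E` eventually (COMMON `C`, `E`, weight `w`),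
`A_i → a_i`, and `C, a_i, B_i ≠ 0` (`i = 1, 2`) imply `ℓ₁ / (a₁·B₁) = ℓ₂ / (a₂·B₂)`.  Proof: `w·E` has the two limits `ℓ_i/(C·a_i·B_i)`; uniqueness; cancel `C`.
[folklore] [cite: VignerasLNM800, Ch. III §2 (proof of Thm. 2.3: comparison of residues)] -/
theorem limit_div_eq_of_common_factor [NeBot l] {w Z₁ Z₂ A₁ A₂ E : α → 𝕜} {ℓ₁ ℓ₂ C B₁ B₂ a₁ a₂ : 𝕜}
    (h₁ : Tendsto (fun s => w s * Z₁ s) l (𝓝 ℓ₁)) (h₂ : Tendsto (fun s => w s * Z₂ s) l (𝓝 ℓ₂))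
    (hfac₁ : ∀ᶠ s in l, Z₁ s = C * A₁ s * B₁ * E s) (hfac₂ : ∀ᶠ s in l, Z₂ s = C * A₂ s * B₂ * E s)
    (hA₁ : Tendsto A₁ l (𝓝 a₁)) (hA₂ : Tendsto A₂ l (𝓝 a₂))
    (hC : C ≠ 0) (ha₁ : a₁ ≠ 0) (ha₂ : a₂ ≠ 0) (hB₁ : B₁ ≠ 0) (hB₂ : B₂ ≠ 0) :
    ℓ₁ / (a₁ * B₁) = ℓ₂ / (a₂ * B₂) := by
  have key : ℓ₁ / (C * a₁ * B₁) = ℓ₂ / (C * a₂ * B₂) :=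
    tendsto_nhds_unique (tendsto_weight_mul_common_of_factorization₄ h₁ hfac₁ hA₁ hC ha₁ hB₁)
      (tendsto_weight_mul_common_of_factorization₄ h₂ hfac₂ hA₂ hC ha₂ hB₂)
  have e₁ : ℓ₁ / (a₁ * B₁) = C * (ℓ₁ / (C * a₁ * B₁)) := by field_simp
  have e₂ : ℓ₂ / (a₂ * B₂) = C * (ℓ₂ / (C * a₂ * B₂)) := by field_simp
  rw [e₁, e₂, key]

/-- Cross-multiplied form of `limit_div_eq_of_common_factor` (no division, for downstream `ℝ≥0∞`∕cast bookkeeping): `ℓ₁·(a₂B₂) = ℓ₂·(a₁B₁)`. [folklore] -/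
theorem limit_mul_eq_of_common_factor [NeBot l] {w Z₁ Z₂ A₁ A₂ E : α → 𝕜} {ℓ₁ ℓ₂ C B₁ B₂ a₁ a₂ : 𝕜}
    (h₁ : Tendsto (fun s => w s * Z₁ s) l (𝓝 ℓ₁)) (h₂ : Tendsto (fun s => w s * Z₂ s) l (𝓝 ℓ₂))
    (hfac₁ : ∀ᶠ s in l, Z₁ s = C * A₁ s * B₁ * E s) (hfac₂ : ∀ᶠ s in l, Z₂ s = C * A₂ s * B₂ * E s)
    (hA₁ : Tendsto A₁ l (𝓝 a₁)) (hA₂ : Tendsto A₂ l (𝓝 a₂))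
    (hC : C ≠ 0) (ha₁ : a₁ ≠ 0) (ha₂ : a₂ ≠ 0) (hB₁ : B₁ ≠ 0) (hB₂ : B₂ ≠ 0) :
    ℓ₁ * (a₂ * B₂) = ℓ₂ * (a₁ * B₁) :=
  (div_eq_div_iff (mul_ne_zero ha₁ hB₁) (mul_ne_zero ha₂ hB₂)).1
    (limit_div_eq_of_common_factor h₁ h₂ hfac₁ hfac₂ hA₁ hA₂ hC ha₁ ha₂ hB₁ hB₂)

/-- **`V₁ = V₂`-shape conclusion.**  In the situation of `limit_div_eq_of_common_factor`, if moreover `a₁·B₁ = a₂·B₂` (in cert §6: the product formula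
`∏_v |det Gram_{h₁}|_v = ∏_v |det Gram_{h₂}|_v = 1`), then the two residues agree: `ℓ₁ = ℓ₂`. [folklore] -/
theorem limit_eq_of_common_factor [NeBot l] {w Z₁ Z₂ A₁ A₂ E : α → 𝕜} {ℓ₁ ℓ₂ C B₁ B₂ a₁ a₂ : 𝕜}
    (h₁ : Tendsto (fun s => w s * Z₁ s) l (𝓝 ℓ₁)) (h₂ : Tendsto (fun s => w s * Z₂ s) l (𝓝 ℓ₂))
    (hfac₁ : ∀ᶠ s in l, Z₁ s = C * A₁ s * B₁ * E s) (hfac₂ : ∀ᶠ s in l, Z₂ s = C * A₂ s * B₂ * E s)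
    (hA₁ : Tendsto A₁ l (𝓝 a₁)) (hA₂ : Tendsto A₂ l (𝓝 a₂))
    (hC : C ≠ 0) (ha₁ : a₁ ≠ 0) (ha₂ : a₂ ≠ 0) (hB₁ : B₁ ≠ 0) (hB₂ : B₂ ≠ 0) (hab : a₁ * B₁ = a₂ * B₂) :
    ℓ₁ = ℓ₂ := by
  have key := limit_div_eq_of_common_factor h₁ h₂ hfac₁ hfac₂ hA₁ hA₂ hC ha₁ ha₂ hB₁ hB₂
  rw [hab] at key
  exact (div_left_inj' (mul_ne_zero ha₂ hB₂)).1 key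

/-- **G14, residue form — `V₁/(a₁B₁) = V₂/(a₂B₂)`.**  With residues `ℓ_i = V_i · P` sharing the (Poisson) factor `P ≠ 0`:
`w·Z_i → V_i·P`, `Z_i = C·A_i·B_i·E` eventually, `A_i → a_i`, `C, P, a_i, B_i ≠ 0` ⇒ `V₁ / (a₁·B₁) = V₂ / (a₂·B₂)`.  This is SWEEP #10c (15) verbatim
over an arbitrary non-trivial filter. [folklore] -/
theorem residue_div_eq_of_common_factor [NeBot l] {w Z₁ Z₂ A₁ A₂ E : α → 𝕜} {V₁ V₂ P C B₁ B₂ a₁ a₂ : 𝕜}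
    (h₁ : Tendsto (fun s => w s * Z₁ s) l (𝓝 (V₁ * P))) (h₂ : Tendsto (fun s => w s * Z₂ s) l (𝓝 (V₂ * P)))
    (hfac₁ : ∀ᶠ s in l, Z₁ s = C * A₁ s * B₁ * E s) (hfac₂ : ∀ᶠ s in l, Z₂ s = C * A₂ s * B₂ * E s)
    (hA₁ : Tendsto A₁ l (𝓝 a₁)) (hA₂ : Tendsto A₂ l (𝓝 a₂))
    (hC : C ≠ 0) (hP : P ≠ 0) (ha₁ : a₁ ≠ 0) (ha₂ : a₂ ≠ 0) (hB₁ : B₁ ≠ 0) (hB₂ : B₂ ≠ 0) :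
    V₁ / (a₁ * B₁) = V₂ / (a₂ * B₂) := by
  have key := limit_div_eq_of_common_factor h₁ h₂ hfac₁ hfac₂ hA₁ hA₂ hC ha₁ ha₂ hB₁ hB₂
  have e₁ : V₁ / (a₁ * B₁) = V₁ * P / (a₁ * B₁) / P := by field_simp
  have e₂ : V₂ / (a₂ * B₂) = V₂ * P / (a₂ * B₂) / P := by field_simp
  rw [e₁, e₂, key]

/-- Residue form, equal normalisations: `a₁·B₁ = a₂·B₂` ⇒ `V₁ = V₂`. [folklore] -/
theorem residue_eq_of_common_factor [NeBot l] {w Z₁ Z₂ A₁ A₂ E : α → 𝕜} {V₁ V₂ P C B₁ B₂ a₁ a₂ : 𝕜}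
    (h₁ : Tendsto (fun s => w s * Z₁ s) l (𝓝 (V₁ * P))) (h₂ : Tendsto (fun s => w s * Z₂ s) l (𝓝 (V₂ * P)))
    (hfac₁ : ∀ᶠ s in l, Z₁ s = C * A₁ s * B₁ * E s) (hfac₂ : ∀ᶠ s in l, Z₂ s = C * A₂ s * B₂ * E s)
    (hA₁ : Tendsto A₁ l (𝓝 a₁)) (hA₂ : Tendsto A₂ l (𝓝 a₂))
    (hC : C ≠ 0) (hP : P ≠ 0) (ha₁ : a₁ ≠ 0) (ha₂ : a₂ ≠ 0) (hB₁ : B₁ ≠ 0) (hB₂ : B₂ ≠ 0) (hab : a₁ * B₁ = a₂ * B₂) :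
    V₁ = V₂ := by
  have key := limit_eq_of_common_factor h₁ h₂ hfac₁ hfac₂ hA₁ hA₂ hC ha₁ ha₂ hB₁ hB₂ hab
  exact (mul_left_inj' hP).1 key

/-- **Ratio form.**  Under the two factorizations (and `E ≠ 0` eventually, e.g. a convergent Euler product of non-vanishing factors) the RATIO of the zeta
functions is eventually the `E`-free, `C`-free quotient `A₁·B₁/(A₂·B₂)`, hence tends to `a₁B₁/(a₂B₂)`. [folklore] -/
theorem tendsto_ratio_of_common_factor {Z₁ Z₂ A₁ A₂ E : α → 𝕜} {C B₁ B₂ a₁ a₂ : 𝕜}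
    (hfac₁ : ∀ᶠ s in l, Z₁ s = C * A₁ s * B₁ * E s) (hfac₂ : ∀ᶠ s in l, Z₂ s = C * A₂ s * B₂ * E s)
    (hE : ∀ᶠ s in l, E s ≠ 0) (hA₁ : Tendsto A₁ l (𝓝 a₁)) (hA₂ : Tendsto A₂ l (𝓝 a₂))
    (hC : C ≠ 0) (ha₂ : a₂ ≠ 0) (hB₂ : B₂ ≠ 0) :
    Tendsto (fun s => Z₁ s / Z₂ s) l (𝓝 (a₁ * B₁ / (a₂ * B₂))) := by
  have hlim : Tendsto (fun s => A₁ s * B₁ / (A₂ s * B₂)) l (𝓝 (a₁ * B₁ / (a₂ * B₂))) :=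
    (hA₁.mul tendsto_const_nhds).div (hA₂.mul tendsto_const_nhds) (mul_ne_zero ha₂ hB₂)
  refine hlim.congr' ?_
  filter_upwards [hfac₁, hfac₂, hE, hA₂.eventually_ne ha₂] with s hs₁ hs₂ hEs hA₂s
  rw [hs₁, hs₂]
  field_simp

/-- **Ratio of residues.**  `w·Z_i → ℓ_i` with `ℓ₂ ≠ 0` and the two factorizations ⇒ `ℓ₁ / ℓ₂ = a₁B₁/(a₂B₂)` (the bus form
«`V(h)/V(h′) = lim Z_h/Z_{h′} = ∏_{v ∈ S} …`»). [folklore] -/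
theorem limit_ratio_eq_of_common_factor [NeBot l] {w Z₁ Z₂ A₁ A₂ E : α → 𝕜} {ℓ₁ ℓ₂ C B₁ B₂ a₁ a₂ : 𝕜}
    (h₁ : Tendsto (fun s => w s * Z₁ s) l (𝓝 ℓ₁)) (h₂ : Tendsto (fun s => w s * Z₂ s) l (𝓝 ℓ₂))
    (hfac₁ : ∀ᶠ s in l, Z₁ s = C * A₁ s * B₁ * E s) (hfac₂ : ∀ᶠ s in l, Z₂ s = C * A₂ s * B₂ * E s)
    (hA₁ : Tendsto A₁ l (𝓝 a₁)) (hA₂ : Tendsto A₂ l (𝓝 a₂))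
    (hC : C ≠ 0) (ha₁ : a₁ ≠ 0) (ha₂ : a₂ ≠ 0) (hB₁ : B₁ ≠ 0) (hB₂ : B₂ ≠ 0) (hℓ₂ : ℓ₂ ≠ 0) :
    ℓ₁ / ℓ₂ = a₁ * B₁ / (a₂ * B₂) := by
  have key := limit_div_eq_of_common_factor h₁ h₂ hfac₁ hfac₂ hA₁ hA₂ hC ha₁ ha₂ hB₁ hB₂
  have h12 : a₁ * B₁ ≠ 0 := mul_ne_zero ha₁ hB₁
  have h22 : a₂ * B₂ ≠ 0 := mul_ne_zero ha₂ hB₂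
  rw [div_eq_div_iff h12 h22] at key
  rw [div_eq_div_iff hℓ₂ h22]
  linear_combination key

end FourFactor

/-! ## §3 The `s → 1⁺` specialisation in the bytes of G3 `Zeta.sig_K2E5QuatZetaResidue` -/

section AtOne

/-- **`zetaRatioSkeleton`** (G14 in the unit-G currency).  Complex-valued zeta functions of a real variable `Z₁, Z₂ : ℝ → ℂ` with simple-pole residues
`((s : ℂ) − 1)·Z_i(s) → V_i·P` as `s → 1⁺` (G3's conclusion shape, `P` the common Poisson factor), factorizations `Z_i(s) = C·A_i(s)·B_i·E(s)` for all
real `s > 1`, archimedean limits `A_i → a_i` along `𝓝[>] 1`, and `C, P, a_i, B_i ≠ 0` ⇒ `V₁/(a₁·B₁) = V₂/(a₂·B₂)`.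
[cite: VignerasLNM800, Ch. III §2 Thm. 2.3 (proof: residue comparison)] [folklore] -/
theorem zetaRatioSkeleton {Z₁ Z₂ A₁ A₂ E : ℝ → ℂ} {V₁ V₂ P C B₁ B₂ a₁ a₂ : ℂ}
    (h₁ : Tendsto (fun s : ℝ => ((s : ℂ) - 1) * Z₁ s) (𝓝[>] (1 : ℝ)) (𝓝 (V₁ * P)))
    (h₂ : Tendsto (fun s : ℝ => ((s : ℂ) - 1) * Z₂ s) (𝓝[>] (1 : ℝ)) (𝓝 (V₂ * P)))
    (hfac₁ : ∀ s : ℝ, 1 < s → Z₁ s = C * A₁ s * B₁ * E s) (hfac₂ : ∀ s : ℝ, 1 < s → Z₂ s = C * A₂ s * B₂ * E s)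
    (hA₁ : Tendsto A₁ (𝓝[>] (1 : ℝ)) (𝓝 a₁)) (hA₂ : Tendsto A₂ (𝓝[>] (1 : ℝ)) (𝓝 a₂))
    (hC : C ≠ 0) (hP : P ≠ 0) (ha₁ : a₁ ≠ 0) (ha₂ : a₂ ≠ 0) (hB₁ : B₁ ≠ 0) (hB₂ : B₂ ≠ 0) :
    V₁ / (a₁ * B₁) = V₂ / (a₂ * B₂) :=
  residue_div_eq_of_common_factor h₁ h₂ (eventually_nhdsWithin_of_forall fun s hs => hfac₁ s hs)
    (eventually_nhdsWithin_of_forall fun s hs => hfac₂ s hs) hA₁ hA₂ hC hP ha₁ ha₂ hB₁ hB₂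

/-- `zetaRatioSkeleton` with equal normalisations `a₁B₁ = a₂B₂` (product formula): `V₁ = V₂` in `ℂ`. [folklore] -/
theorem zetaRatioSkeleton_eq {Z₁ Z₂ A₁ A₂ E : ℝ → ℂ} {V₁ V₂ P C B₁ B₂ a₁ a₂ : ℂ}
    (h₁ : Tendsto (fun s : ℝ => ((s : ℂ) - 1) * Z₁ s) (𝓝[>] (1 : ℝ)) (𝓝 (V₁ * P)))
    (h₂ : Tendsto (fun s : ℝ => ((s : ℂ) - 1) * Z₂ s) (𝓝[>] (1 : ℝ)) (𝓝 (V₂ * P)))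
    (hfac₁ : ∀ s : ℝ, 1 < s → Z₁ s = C * A₁ s * B₁ * E s) (hfac₂ : ∀ s : ℝ, 1 < s → Z₂ s = C * A₂ s * B₂ * E s)
    (hA₁ : Tendsto A₁ (𝓝[>] (1 : ℝ)) (𝓝 a₁)) (hA₂ : Tendsto A₂ (𝓝[>] (1 : ℝ)) (𝓝 a₂))
    (hC : C ≠ 0) (hP : P ≠ 0) (ha₁ : a₁ ≠ 0) (ha₂ : a₂ ≠ 0) (hB₁ : B₁ ≠ 0) (hB₂ : B₂ ≠ 0) (hab : a₁ * B₁ = a₂ * B₂) :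
    V₁ = V₂ :=
  residue_eq_of_common_factor h₁ h₂ (eventually_nhdsWithin_of_forall fun s hs => hfac₁ s hs)
    (eventually_nhdsWithin_of_forall fun s hs => hfac₂ s hs) hA₁ hA₂ hC hP ha₁ ha₂ hB₁ hB₂ hab

/-- **`zetaRatioSkeleton_toReal`** — the limits in the LITERAL shape of G3 :112, `((V_i.toReal : ℂ) * I_i) / (F.toReal : ℂ)` with `V_i : ℝ≥0∞` the covolumes
`quotientMeasure … univ`, `I_i = ∫ Φ_{h_i} dν⁴` (equal for the common test function: `I₁ = I₂ ≠ 0`) and `F = ν⁴(piFundamentalDomain)` (`0 < F.toReal`):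
conclusion `(V₁.toReal : ℂ)/(a₁B₁) = (V₂.toReal : ℂ)/(a₂B₂)`. [folklore] -/
theorem zetaRatioSkeleton_toReal {Z₁ Z₂ A₁ A₂ E : ℝ → ℂ} {V₁ V₂ F : ℝ≥0∞} {I₁ I₂ C B₁ B₂ a₁ a₂ : ℂ}
    (h₁ : Tendsto (fun s : ℝ => ((s : ℂ) - 1) * Z₁ s) (𝓝[>] (1 : ℝ)) (𝓝 ((V₁.toReal : ℂ) * I₁ / (F.toReal : ℂ))))
    (h₂ : Tendsto (fun s : ℝ => ((s : ℂ) - 1) * Z₂ s) (𝓝[>] (1 : ℝ)) (𝓝 ((V₂.toReal : ℂ) * I₂ / (F.toReal : ℂ))))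
    (hI : I₁ = I₂) (hI₁ : I₁ ≠ 0) (hF : F.toReal ≠ 0)
    (hfac₁ : ∀ s : ℝ, 1 < s → Z₁ s = C * A₁ s * B₁ * E s) (hfac₂ : ∀ s : ℝ, 1 < s → Z₂ s = C * A₂ s * B₂ * E s)
    (hA₁ : Tendsto A₁ (𝓝[>] (1 : ℝ)) (𝓝 a₁)) (hA₂ : Tendsto A₂ (𝓝[>] (1 : ℝ)) (𝓝 a₂))
    (hC : C ≠ 0) (ha₁ : a₁ ≠ 0) (ha₂ : a₂ ≠ 0) (hB₁ : B₁ ≠ 0) (hB₂ : B₂ ≠ 0) :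
    (V₁.toReal : ℂ) / (a₁ * B₁) = (V₂.toReal : ℂ) / (a₂ * B₂) := by
  subst hI
  have hF' : (F.toReal : ℂ) ≠ 0 := by exact_mod_cast hF
  have hP : I₁ / (F.toReal : ℂ) ≠ 0 := div_ne_zero hI₁ hF'
  refine zetaRatioSkeleton (P := I₁ / (F.toReal : ℂ)) ?_ ?_ hfac₁ hfac₂ hA₁ hA₂ hC hP ha₁ ha₂ hB₁ hB₂
  · simpa only [mul_div_assoc] using h₁
  · simpa only [mul_div_assoc] using h₂

/-- **`covol_eq_of_zetaResidue_comparison`** — THE OUTPUT CURRENCY OF G0D: two FINITE covolumes `V₁, V₂ : ℝ≥0∞` (finite by Fujisaki compactness G1′) whose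
zeta residues in G3's literal shape share `I₁ = I₂ ≠ 0`, `F` (`F.toReal ≠ 0`), the constant `C`, the good Euler product `E` and have bad∕arch normalisations with
`a₁B₁ = a₂B₂` (product formula for `det Gram`) are EQUAL in `ℝ≥0∞`. [cite: VignerasLNM800, Ch. III §2 Thm. 2.3] [folklore] -/
theorem covol_eq_of_zetaResidue_comparison {Z₁ Z₂ A₁ A₂ E : ℝ → ℂ} {V₁ V₂ F : ℝ≥0∞} {I₁ I₂ C B₁ B₂ a₁ a₂ : ℂ}
    (hV₁ : V₁ ≠ ∞) (hV₂ : V₂ ≠ ∞)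
    (h₁ : Tendsto (fun s : ℝ => ((s : ℂ) - 1) * Z₁ s) (𝓝[>] (1 : ℝ)) (𝓝 ((V₁.toReal : ℂ) * I₁ / (F.toReal : ℂ))))
    (h₂ : Tendsto (fun s : ℝ => ((s : ℂ) - 1) * Z₂ s) (𝓝[>] (1 : ℝ)) (𝓝 ((V₂.toReal : ℂ) * I₂ / (F.toReal : ℂ))))
    (hI : I₁ = I₂) (hI₁ : I₁ ≠ 0) (hF : F.toReal ≠ 0)
    (hfac₁ : ∀ s : ℝ, 1 < s → Z₁ s = C * A₁ s * B₁ * E s) (hfac₂ : ∀ s : ℝ, 1 < s → Z₂ s = C * A₂ s * B₂ * E s)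
    (hA₁ : Tendsto A₁ (𝓝[>] (1 : ℝ)) (𝓝 a₁)) (hA₂ : Tendsto A₂ (𝓝[>] (1 : ℝ)) (𝓝 a₂))
    (hC : C ≠ 0) (ha₁ : a₁ ≠ 0) (ha₂ : a₂ ≠ 0) (hB₁ : B₁ ≠ 0) (hB₂ : B₂ ≠ 0) (hab : a₁ * B₁ = a₂ * B₂) :
    V₁ = V₂ := by
  have key := zetaRatioSkeleton_toReal h₁ h₂ hI hI₁ hF hfac₁ hfac₂ hA₁ hA₂ hC ha₁ ha₂ hB₁ hB₂
  rw [hab] at key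
  have hcast : (V₁.toReal : ℂ) = (V₂.toReal : ℂ) := (div_left_inj' (mul_ne_zero ha₂ hB₂)).1 key
  exact (ENNReal.toReal_eq_toReal_iff' hV₁ hV₂).1 (by exact_mod_cast hcast)

end AtOne

end Summit.HodgeConjecture.HodgeConjecture.Cruxes.H413.K2E5ZetaRatioSkeleton

end
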